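import Mathlib
import Summits.ValiantsHypothesis.ValiantsHypothesis.Theorems.LacunarySymmetroidMatrixDescartesInertiaIndexFormula

/-!
# `MatrixDescartes` (stmt-ValiantsHypothesis-18050) — INERTIA KIT, IV-c: THE ONE-TYPE LAW — if every positive root of `det F`
# is of negative type (or every one of positive type) then the positive roots counted WITH MULTIPLICITY number at most `m`,
# for EVERY real symmetric lacunary pencil `F(X) = ∑ₖ X^{dₖ}Sₖ` at EVERY format

HONEST FRAMING.  Cell `pub-symmetroid`, seat `val-sym-mdr-p2` (gen 17); helper file `--supports` the crux
`Theses.LacunarySymmetroid.MatrixDescartes`, NO closure claim.  A new FORMAT-FREE family on which `Z₊ ≤ m`: it contains g16's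
intrinsic one-crossing sector (`…DefiniteMomentsOneCrossing`: `S₀ ≻ 0` and every Rayleigh `K`-nomial with `≤ 1` positive root
force every positive root to be of negative type) and each window of the hyperbolic sector, but it asks NOTHING about the
Rayleigh polynomials away from the kernels at the roots — a pointwise first-order condition at the roots of `det F`.  Nothing
here bears on the crux in its window, on `stub_twoSided`, on `DoorA26`/`DoorA34`, registers, or `VP ≠ VNP`.

CONTENT.  `card_posRoots_multiset_le_of_negType`: if every POSITIVE root `t` of `det F` is of negative type (every non-zero kernel
vector `u` of `F(t)` has `P_u′(t) < 0`), then the positive roots of `det F` counted with multiplicity number at most `card ι`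
— indeed exactly `ν(F(b)) − ν(F(a))` between a non-singular scale `a` below and `b` above all positive roots (the one-type
window law of `…InertiaIndexFormula`); `card_posRoots_le_of_negType`: the same for distinct roots; `…_of_posType`: mirrors.
(`det F ≡ 0` is allowed: Mathlib's `roots 0 = 0`.)  READING: by the index formula (`Inertia.index_formula`), on a window whose
roots are all of definite type `#roots ≤ m + 2·min(N⁻, N⁺)`: beating the inertia budget `m` needs roots of BOTH types
(«revivals») — e.g. nine simple positive roots at `m = 2` force at least four of each type.
[folklore]; axioms standard; no definitions.
-/

-- layout Summits/ValiantsHypothesis/ValiantsHypothesis forces the duplicated namespace component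
set_option linter.dupNamespace false

namespace Summit.ValiantsHypothesis.ValiantsHypothesis.Theorems.LacunarySymmetroidMatrixDescartes

open Matrix Finset Polynomial
open scoped BigOperators Topology

namespace Inertia

variable {ι : Type} [Fintype ι] [DecidableEq ι]

section Pencil

variable {κ : Type} [Fintype κ]

/-! ## §4 The one-type law for positive roots -/

/-- **THE ONE-TYPE LAW (negative type): positive roots counted with multiplicity `≤ card ι`.**  `F(X) = ∑ₖ X^{dₖ}Sₖ` real
symmetric with `det F ≢ 0`; if every POSITIVE root of `det F` is of negative type, then the positive roots of `det F` counted
with multiplicity number at most `card ι`. [folklore] -/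
theorem card_posRoots_multiset_le_of_negType (d : κ → ℕ) (S : κ → Matrix ι ι ℝ) (hS : ∀ k, (S k).IsSymm)
    (hneg : ∀ t, 0 < t → (∑ k, t ^ d k • S k).det = 0 → ∀ u : ι → ℝ, (∑ k, t ^ d k • S k) *ᵥ u = 0 → u ≠ 0 →
      (derivative (∑ k, C (u ⬝ᵥ (S k *ᵥ u)) * (X : ℝ[X]) ^ d k)).eval t < 0) :
    Multiset.card ((Matrix.det (∑ k, ((X : ℝ[X]) ^ d k) • (S k).map C)).roots.filter (fun t => 0 < t))
      ≤ Fintype.card ι := by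
  classical
  set P := Matrix.det (∑ k, ((X : ℝ[X]) ^ d k) • (S k).map C) with hP
  by_cases hdet : P = 0
  · rw [hdet, roots_zero]; simp
  set R := P.roots.toFinset.filter (fun t => 0 < t) with hR
  by_cases hRe : R = ∅
  · -- no positive root at all
    have h0 : P.roots.filter (fun t => 0 < t) = 0 := by
      rw [Multiset.filter_eq_nil]
      intro t ht hpt
      have : t ∈ R := Finset.mem_filter.2 ⟨Multiset.mem_toFinset.2 ht, hpt⟩
      rw [hRe] at this
      simp at this
    rw [h0]
    simp
  · obtain ⟨t₁, ht₁⟩ := Finset.nonempty_of_ne_empty hRe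
    have hRne : R.Nonempty := ⟨t₁, ht₁⟩
    -- a scale below and a scale above all positive roots
    set a := R.min' hRne / 2 with ha_def
    set b := R.max' hRne + 1 with hb_def
    have hmin_pos : 0 < R.min' hRne := (Finset.mem_filter.1 (Finset.min'_mem R hRne)).2
    have ha_pos : 0 < a := by rw [ha_def]; linarith
    have hroots_in : ∀ t, 0 < t → (∑ k, t ^ d k • S k).det = 0 → a < t ∧ t < b := by
      intro t ht hdt
      have htR : t ∈ R := Finset.mem_filter.2 ⟨mem_rootSet_of_det_eq_zero d S hdet hdt, ht⟩
      have h1 := Finset.min'_le R t htR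
      have h2 := Finset.le_max' R t htR
      constructor
      · rw [ha_def]; linarith
      · rw [hb_def]; linarith
    have hab : a < b := by
      have h1 := Finset.min'_le R t₁ ht₁
      have h2 := Finset.le_max' R t₁ ht₁
      rw [ha_def, hb_def]; linarith
    have ha : (∑ k, a ^ d k • S k).det ≠ 0 := fun h => by
      have := (hroots_in a ha_pos h).1; exact lt_irrefl a this
    have hb : (∑ k, b ^ d k • S k).det ≠ 0 := fun h => by
      have := (hroots_in b (lt_trans ha_pos hab) h).2; exact lt_irrefl b this
    have hwin := (card_roots_Ioo_add_negIndex_eq_of_negType d S hS hab ha hb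
      (fun t h1 h2 hdt => hneg t (lt_trans ha_pos h1) hdt)).1
    rw [← hP] at hwin
    have hfilt : P.roots.filter (fun t => 0 < t) = P.roots.filter (fun t => a < t ∧ t < b) := by
      refine Multiset.filter_congr fun t ht => ⟨fun hpt => ?_, fun h => lt_trans ha_pos h.1⟩
      have hdt : (∑ k, t ^ d k • S k).det = 0 := by
        have h := (mem_roots hdet).1 ht
        rwa [IsRoot, DefiniteMoments.eval_det_pencil] at h
      exact hroots_in t hpt hdt
    rw [hfilt]
    have hle : Fintype.card {j // (isHermitian_pencil d S hS b).eigenvalues j < 0} ≤ Fintype.card ι :=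
      Fintype.card_subtype_le _
    omega

/-- **THE ONE-TYPE LAW (negative type), distinct roots**: `Z₊ ≤ card ι`. [folklore] -/
theorem card_posRoots_le_of_negType (d : κ → ℕ) (S : κ → Matrix ι ι ℝ) (hS : ∀ k, (S k).IsSymm)
    (hneg : ∀ t, 0 < t → (∑ k, t ^ d k • S k).det = 0 → ∀ u : ι → ℝ, (∑ k, t ^ d k • S k) *ᵥ u = 0 → u ≠ 0 →
      (derivative (∑ k, C (u ⬝ᵥ (S k *ᵥ u)) * (X : ℝ[X]) ^ d k)).eval t < 0) :
    ((Matrix.det (∑ k, ((X : ℝ[X]) ^ d k) • (S k).map C)).roots.toFinset.filter (fun t => 0 < t)).card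
      ≤ Fintype.card ι := by
  classical
  refine le_trans ?_ (card_posRoots_multiset_le_of_negType d S hS hneg)
  rw [← Multiset.toFinset_filter]
  exact Multiset.toFinset_card_le _

/-- **THE ONE-TYPE LAW (positive type)**: if every positive root of `det F` is of positive type then the positive roots counted
with multiplicity number at most `card ι` (apply the negative-type law to the letters `−Sₖ`). [folklore] -/
theorem card_posRoots_multiset_le_of_posType (d : κ → ℕ) (S : κ → Matrix ι ι ℝ) (hS : ∀ k, (S k).IsSymm)
    (hpos : ∀ t, 0 < t → (∑ k, t ^ d k • S k).det = 0 → ∀ u : ι → ℝ, (∑ k, t ^ d k • S k) *ᵥ u = 0 → u ≠ 0 →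
      0 < (derivative (∑ k, C (u ⬝ᵥ (S k *ᵥ u)) * (X : ℝ[X]) ^ d k)).eval t) :
    Multiset.card ((Matrix.det (∑ k, ((X : ℝ[X]) ^ d k) • (S k).map C)).roots.filter (fun t => 0 < t))
      ≤ Fintype.card ι := by
  classical
  set P := Matrix.det (∑ k, ((X : ℝ[X]) ^ d k) • (S k).map C) with hP
  by_cases hdet : P = 0
  · rw [hdet, roots_zero]; simp
  set R := P.roots.toFinset.filter (fun t => 0 < t) with hR
  by_cases hRe : R = ∅
  · have h0 : P.roots.filter (fun t => 0 < t) = 0 := by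
      rw [Multiset.filter_eq_nil]
      intro t ht hpt
      have : t ∈ R := Finset.mem_filter.2 ⟨Multiset.mem_toFinset.2 ht, hpt⟩
      rw [hRe] at this
      simp at this
    rw [h0]
    simp
  · obtain ⟨t₁, ht₁⟩ := Finset.nonempty_of_ne_empty hRe
    have hRne : R.Nonempty := ⟨t₁, ht₁⟩
    set a := R.min' hRne / 2 with ha_def
    set b := R.max' hRne + 1 with hb_def
    have hmin_pos : 0 < R.min' hRne := (Finset.mem_filter.1 (Finset.min'_mem R hRne)).2
    have ha_pos : 0 < a := by rw [ha_def]; linarith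
    have hroots_in : ∀ t, 0 < t → (∑ k, t ^ d k • S k).det = 0 → a < t ∧ t < b := by
      intro t ht hdt
      have htR : t ∈ R := Finset.mem_filter.2 ⟨mem_rootSet_of_det_eq_zero d S hdet hdt, ht⟩
      have h1 := Finset.min'_le R t htR
      have h2 := Finset.le_max' R t htR
      constructor
      · rw [ha_def]; linarith
      · rw [hb_def]; linarith
    have hab : a < b := by
      have h1 := Finset.min'_le R t₁ ht₁
      have h2 := Finset.le_max' R t₁ ht₁
      rw [ha_def, hb_def]; linarith
    have ha : (∑ k, a ^ d k • S k).det ≠ 0 := fun h => by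
      have := (hroots_in a ha_pos h).1; exact lt_irrefl a this
    have hb : (∑ k, b ^ d k • S k).det ≠ 0 := fun h => by
      have := (hroots_in b (lt_trans ha_pos hab) h).2; exact lt_irrefl b this
    have hwin := (card_roots_Ioo_add_negIndex_eq_of_posType d S hS hab ha hb
      (fun t h1 h2 hdt => hpos t (lt_trans ha_pos h1) hdt)).1
    rw [← hP] at hwin
    have hfilt : P.roots.filter (fun t => 0 < t) = P.roots.filter (fun t => a < t ∧ t < b) := by
      refine Multiset.filter_congr fun t ht => ⟨fun hpt => ?_, fun h => lt_trans ha_pos h.1⟩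
      have hdt : (∑ k, t ^ d k • S k).det = 0 := by
        have h := (mem_roots hdet).1 ht
        rwa [IsRoot, DefiniteMoments.eval_det_pencil] at h
      exact hroots_in t hpt hdt
    rw [hfilt]
    have hle : Fintype.card {j // (isHermitian_pencil d S hS a).eigenvalues j < 0} ≤ Fintype.card ι :=
      Fintype.card_subtype_le _
    omega

/-- **THE ONE-TYPE LAW (positive type), distinct roots**: `Z₊ ≤ card ι`. [folklore] -/
theorem card_posRoots_le_of_posType (d : κ → ℕ) (S : κ → Matrix ι ι ℝ) (hS : ∀ k, (S k).IsSymm)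
    (hpos : ∀ t, 0 < t → (∑ k, t ^ d k • S k).det = 0 → ∀ u : ι → ℝ, (∑ k, t ^ d k • S k) *ᵥ u = 0 → u ≠ 0 →
      0 < (derivative (∑ k, C (u ⬝ᵥ (S k *ᵥ u)) * (X : ℝ[X]) ^ d k)).eval t) :
    ((Matrix.det (∑ k, ((X : ℝ[X]) ^ d k) • (S k).map C)).roots.toFinset.filter (fun t => 0 < t)).card
      ≤ Fintype.card ι := by
  classical
  refine le_trans ?_ (card_posRoots_multiset_le_of_posType d S hS hpos)
  rw [← Multiset.toFinset_filter]
  exact Multiset.toFinset_card_le _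

/-! ## §5 Few revivals -/

/-- **THE FEW-REVIVALS LAW.**  `F(X) = ∑ₖ X^{dₖ}Sₖ` real symmetric with every positive root of `det F` of definite type; if the
positive roots of POSITIVE type («revivals»: an eigenvalue returns upward through `0`) counted with multiplicity number at most `R`,
then ALL positive roots counted with multiplicity number at most `card ι + 2R` (index formula between a scale below and a scale
above the positive roots). [folklore] -/
theorem card_posRoots_multiset_le_of_fewRevivals (d : κ → ℕ) (S : κ → Matrix ι ι ℝ) (hS : ∀ k, (S k).IsSymm)
    (htype : ∀ t, 0 < t → (∑ k, t ^ d k • S k).det = 0 →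
      (∀ u : ι → ℝ, (∑ k, t ^ d k • S k) *ᵥ u = 0 → u ≠ 0 →
        (derivative (∑ k, C (u ⬝ᵥ (S k *ᵥ u)) * (X : ℝ[X]) ^ d k)).eval t < 0) ∨
      (∀ u : ι → ℝ, (∑ k, t ^ d k • S k) *ᵥ u = 0 → u ≠ 0 →
        0 < (derivative (∑ k, C (u ⬝ᵥ (S k *ᵥ u)) * (X : ℝ[X]) ^ d k)).eval t))
    (negType : ℝ → Prop) [DecidablePred negType]
    (hnegType : ∀ t, 0 < t → (∑ k, t ^ d k • S k).det = 0 →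
      (negType t ↔ ∀ u : ι → ℝ, (∑ k, t ^ d k • S k) *ᵥ u = 0 → u ≠ 0 →
        (derivative (∑ k, C (u ⬝ᵥ (S k *ᵥ u)) * (X : ℝ[X]) ^ d k)).eval t < 0))
    (R : ℕ) (hR : Multiset.card ((Matrix.det (∑ k, ((X : ℝ[X]) ^ d k) • (S k).map C)).roots.filter
      (fun t => 0 < t ∧ ¬ negType t)) ≤ R) :
    Multiset.card ((Matrix.det (∑ k, ((X : ℝ[X]) ^ d k) • (S k).map C)).roots.filter (fun t => 0 < t))
      ≤ Fintype.card ι + 2 * R := by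
  classical
  set P := Matrix.det (∑ k, ((X : ℝ[X]) ^ d k) • (S k).map C) with hP
  by_cases hdet : P = 0
  · rw [hdet, roots_zero]; simp
  set Rt := P.roots.toFinset.filter (fun t => 0 < t) with hRt
  by_cases hRe : Rt = ∅
  · have h0 : P.roots.filter (fun t => 0 < t) = 0 := by
      rw [Multiset.filter_eq_nil]
      intro t ht hpt
      have : t ∈ Rt := Finset.mem_filter.2 ⟨Multiset.mem_toFinset.2 ht, hpt⟩
      rw [hRe] at this
      simp at this
    rw [h0]
    simp
  · obtain ⟨t₁, ht₁⟩ := Finset.nonempty_of_ne_empty hRe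
    have hRne : Rt.Nonempty := ⟨t₁, ht₁⟩
    set a := Rt.min' hRne / 2 with ha_def
    set b := Rt.max' hRne + 1 with hb_def
    have hmin_pos : 0 < Rt.min' hRne := (Finset.mem_filter.1 (Finset.min'_mem Rt hRne)).2
    have ha_pos : 0 < a := by rw [ha_def]; linarith
    have hroots_in : ∀ t, 0 < t → (∑ k, t ^ d k • S k).det = 0 → a < t ∧ t < b := by
      intro t ht hdt
      have htR : t ∈ Rt := Finset.mem_filter.2 ⟨mem_rootSet_of_det_eq_zero d S hdet hdt, ht⟩
      have h1 := Finset.min'_le Rt t htR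
      have h2 := Finset.le_max' Rt t htR
      constructor
      · rw [ha_def]; linarith
      · rw [hb_def]; linarith
    have hab : a < b := by
      have h1 := Finset.min'_le Rt t₁ ht₁
      have h2 := Finset.le_max' Rt t₁ ht₁
      rw [ha_def, hb_def]; linarith
    have ha : (∑ k, a ^ d k • S k).det ≠ 0 := fun h => by
      have := (hroots_in a ha_pos h).1; exact lt_irrefl a this
    have hb : (∑ k, b ^ d k • S k).det ≠ 0 := fun h => by
      have := (hroots_in b (lt_trans ha_pos hab) h).2; exact lt_irrefl b this
    obtain ⟨hν, -, hsum⟩ := index_formula d S hS hab ha hb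
      (fun t h1 h2 hdt => htype t (lt_trans ha_pos h1) hdt) negType
      (fun t h1 h2 hdt => hnegType t (lt_trans ha_pos h1) hdt)
    rw [← hP] at hν hsum
    -- positive roots = roots in `(a, b)`, for every sub-selection
    have hiff : ∀ t ∈ P.roots, (0 < t ↔ a < t ∧ t < b) := by
      intro t ht
      refine ⟨fun hpt => ?_, fun h => lt_trans ha_pos h.1⟩
      have hdt : (∑ k, t ^ d k • S k).det = 0 := by
        have h := (mem_roots hdet).1 ht
        rwa [IsRoot, DefiniteMoments.eval_det_pencil] at h
      exact hroots_in t hpt hdt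
    have hfilt : P.roots.filter (fun t => 0 < t) = P.roots.filter (fun t => a < t ∧ t < b) :=
      Multiset.filter_congr fun t ht => hiff t ht
    have hfilt' : P.roots.filter (fun t => 0 < t ∧ ¬ negType t)
        = P.roots.filter (fun t => (a < t ∧ t < b) ∧ ¬ negType t) :=
      Multiset.filter_congr fun t ht => by rw [hiff t ht]
    rw [hfilt]
    rw [hfilt'] at hR
    have hle : Fintype.card {j // (isHermitian_pencil d S hS b).eigenvalues j < 0} ≤ Fintype.card ι :=
      Fintype.card_subtype_le _
    omega

end Pencil

end Inertia

end Summit.ValiantsHypothesis.ValiantsHypothesis.Theorems.LacunarySymmetroidMatrixDescartes
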